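import Literature.AlgebraicGeometry.Resolution.AlterationsSemiStableNodeStructure
import Literature.AlgebraicGeometry.Resolution.AlterationsFormalNodesSingHolds
import HarnessLib

/-!
# De Jong 1996, 3.3 with 3.4 ¶1–2 at the closed points of `T`: the discharge
# `DeJong1996NodeLocalStructureCodimTwo_holds`

Topic: `Literature/AlgebraicGeometry/Resolution`. Discharge of the named fact
`DeJong1996NodeLocalStructureCodimTwo` of `AlterationsSemiStableNodeStructure.lean` (de Jong 1996,
3.3 with 3.4 ¶1–2, pp. 63–64, read at the closed points of a codimension-2 component `T` of
`Sing(X)`: the split presentation `𝒪̂_{X,x₁} ≅ k⟦u, v, T⟧/(uv - ∏ Tᵢ^{νᵢ})` carries the completed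
ideal of `T` onto `(u, v, T_{i₀})`, `ν_{i₀} ≥ 2`, and `ν_{i₀} = n_T`). That file proves the fact from
the split nodal structure with the trace of `Sing(f)`
(`DeJong1996NodeLocalStructureCodimTwo.of_splitNodalStructureSing`); the discharge of the latter,
`DeJong1996SplitNodalStructureSing_holds` (`AlterationsFormalNodesSingHolds.lean`), imports that
file, so the one-line assembly lives here. Everything is PROVED; no definition, no named fact.

## Sources

* A. J. de Jong, *Smoothness, semi-stability and alterations*, Publ. Math. IHÉS 83 (1996) 51–93:
  2.23 with its Remark (pp. 61–62), 3.3–3.4 (pp. 63–64), 4.24 (p. 75). [DeJong1996]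
-/

noncomputable section

namespace Literature.AlgebraicGeometry.Resolution

universe u

/-- **de Jong 1996, 3.3 with 3.4 ¶1–2 at the closed points of `T`
(`DeJong1996NodeLocalStructureCodimTwo`) — PROVED**: the transfer
`DeJong1996NodeLocalStructureCodimTwo.of_splitNodalStructureSing` applied to the discharged split
nodal structure with the trace of `Sing(f)` (`DeJong1996SplitNodalStructureSing_holds`, 2.23 with
its Remark and 3.3 at closed points). [cite: DeJong1996, 3.3–3.4, pp. 63–64] -/
theorem DeJong1996NodeLocalStructureCodimTwo_holds : DeJong1996NodeLocalStructureCodimTwo.{u} :=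
  DeJong1996NodeLocalStructureCodimTwo.of_splitNodalStructureSing
    DeJong1996SplitNodalStructureSing_holds

end Literature.AlgebraicGeometry.Resolution

end
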